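import Summits.Ventures.HodgeKum4.Theorems.KummerFixedLocusL1HilbCertData
import Mathlib.Data.Matrix.Basis
import HarnessLib

/-!
# Lane (V), line v2p5 — stub S-D: the loop-superalgebra certificate (S2) in KERNEL form (`decide`, sparse matrices)

Cell `hodge-kum4`, crux stmt-Ventures-20141, registered stub `stub_cert : LieCert` of the v2p5 skeleton (definitions
`…L1HilbDefs`, sparse plumbing `…L1HilbSparse`, data and checker `…L1HilbCertData`).  Every node matrix has at most
`16` non-zero entries, so the verification of the whole certificate is a small computation on sparse integer matrices
done by the KERNEL (`decide +kernel`; no `native_decide`, standard axioms; ≈ 80 s): `checkProg_eq_true`,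
`checkEO_eq_true`, `checkEE_eq_true`, `checkEOc_eq_true`, `checkT_eq_true`, `eval_mulS`, `eval_lamS`; `stub_cert`
repackages them, through the bridge lemmas of `…L1HilbSparse`, as the integer-matrix identities of `LieCert`.
Nothing here asserts L1-Hilb(n) / L1 / HC_Kum4Type / HC.
-/

noncomputable section

namespace Summit.Ventures.HodgeKum4.L1Hilb

namespace Cert

/-! ### Plumbing -/

/-- A sparse matrix all of whose listed entries `(q, p, c)` satisfy `|q| = |p| + d` is homogeneous of degree `d`. -/
theorem SMat.isHomogMat_eval {A : SMat} {d : ℤ}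
    (h : (A.all fun e ↦ decide ((deg4N e.1 : ℤ) = deg4N e.2.1 + d)) = true) : IsHomogMat (SMat.eval A) d := by
  intro Q P hQP
  rw [SMat.eval_apply] at hQP
  simp only [List.all_eq_true, decide_eq_true_eq] at h
  obtain ⟨e, he, h1, h2⟩ := SMat.exists_of_entry_ne_zero hQP
  have := h e he
  rw [h1, h2] at this
  exact this

/-- `eval` of the sparse super-bracket is the model's `sbrMat`. -/
theorem SMat.eval_sbr' (A : SMat) (da : ℤ) (B : SMat) (db : ℤ) (hA : SMat.wf A = true) (hB : SMat.wf B = true) :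
    SMat.eval (SMat.sbr A da B db) = sbrMat (SMat.eval A) da (SMat.eval B) db := by
  rw [SMat.eval_sbr A da B db hA hB, sbrMat]

/-- Unfolding `nodesRev`. -/
theorem nodesRev_succ (k : ℕ) : nodesRev (k + 1) = nodeS k :: nodesRev k := rfl

/-- Position `m` of `nodesRev k` is node `k − 1 − m`. -/
theorem nodesRev_getD {k m : ℕ} (hm : m < k) (d : SMat × ℤ × ℤ) : (nodesRev k).getD m d = nodeS (k - 1 - m) := by
  induction k generalizing m with
  | zero => omega
  | succ k ih =>
    rw [nodesRev_succ]
    cases m with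
    | zero => simp
    | succ m =>
      rw [List.getD_cons_succ, ih (by omega)]
      congr 1
      omega

/-! ### The checks, by the kernel -/

/-- The program check (wf, homogeneity, structure), by the kernel. -/
theorem checkProg_eq_true : checkProg = true := by
  decide +kernel

/-- The `E`/`O` degree check, by the kernel. -/
theorem checkEO_eq_true : checkEO = true := by
  decide +kernel

/-- `[E,E] ⊇ E`, by the kernel. -/
theorem checkEE_eq_true : checkEE = true := by
  decide +kernel

/-- `[E,O] ⊇ O`, by the kernel. -/
theorem checkEOc_eq_true : checkEOc = true := by
  decide +kernel

/-- Targets, by the kernel. -/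
theorem checkT_eq_true : checkT = true := by
  decide +kernel

/-- The sparse generators are the model's matrices `mulMat I`. -/
theorem eval_mulS : ∀ I : Fin 16, (mulS I).eval = mulMat I := by
  decide +kernel

/-- The sparse `Λ` is the model's `lamMat`. -/
theorem eval_lamS : lamS.eval = lamMat := by
  decide +kernel

/-- The generator bitmasks have degrees `1, 2, 3`. -/
theorem deg4_genMasks : ∀ g : Fin 14, deg4 (genMasks.get ⟨g.val, by simp [genMasks]⟩) ∈ ({1, 2, 3} : Set ℕ) := by
  decide +kernel

/-- The sparse identity target is `1`. -/
theorem eval_unitS_zero : (unitS 0).eval = 1 := by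
  decide +kernel

/-- The sparse targets `E_{I,0}`. -/
theorem eval_unitS : ∀ I : Fin 16, I ≠ 0 → (unitS I.val).eval = Matrix.single I (0 : Fin 16) (1 : ℤ) := by
  decide +kernel

/-! ### From the Boolean checks to `LieCert` -/

/-- Every program node passes `checkNode`. -/
theorem checkNode_of_lt {k : ℕ} (hk : k < 447) : checkNode k = true := by
  have h := checkProg_eq_true
  rw [checkProg, List.all_eq_true] at h
  exact h k (List.mem_range.mpr hk)

/-- Node matrices have indices `< 16`. -/
theorem wf_nodeS {k : ℕ} (hk : k < 447) : SMat.wf (nodeS k).1 = true := by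
  have h := checkNode_of_lt hk
  simp only [checkNode, Bool.and_eq_true] at h
  exact h.1.1

/-- Node matrices are `deg4`-homogeneous of their R-degree. -/
theorem homog_nodeS {k : ℕ} (hk : k < 447) : IsHomogMat (nodeS k).1.eval (nodeS k).2.2 := by
  have h := checkNode_of_lt hk
  simp only [checkNode, Bool.and_eq_true] at h
  exact SMat.isHomogMat_eval h.1.2

/-- `isE` is membership in `eNodes`. -/
theorem isE_iff {k : ℕ} : isE k = true ↔ k ∈ eNodes := by simp [isE]

/-- `isO` is membership in `oNodes`. -/
theorem isO_iff {k : ℕ} : isO k = true ↔ k ∈ oNodes := by simp [isO]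

/-- `E` nodes are program nodes of `t`-degree `−2`. -/
theorem lt_of_isE {k : ℕ} (h : isE k = true) : k < 447 ∧ (nodeS k).2.1 = -2 := by
  have hc := checkEO_eq_true
  simp only [checkEO, Bool.and_eq_true, List.all_eq_true, decide_eq_true_eq, beq_iff_eq] at hc
  exact hc.1 k (isE_iff.mp h)

/-- `O` nodes are program nodes of `t`-degree `−3`. -/
theorem lt_of_isO {k : ℕ} (h : isO k = true) : k < 447 ∧ (nodeS k).2.1 = -3 := by
  have hc := checkEO_eq_true
  simp only [checkEO, Bool.and_eq_true, List.all_eq_true, decide_eq_true_eq, beq_iff_eq] at hc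
  exact hc.2 k (isO_iff.mp h)

/-- Evaluation of the right-hand side of a bracket record (all operands are program nodes). -/
theorem eval_rhsBr (terms : List (ℕ × ℕ × ℤ)) (h : ∀ t ∈ terms, t.1 < 447 ∧ t.2.1 < 447) :
    (rhsBr terms).eval = (terms.map fun t ↦ t.2.2 •
      sbrMat (nodeS t.1).1.eval (nodeS t.1).2.2 (nodeS t.2.1).1.eval (nodeS t.2.1).2.2).sum := by
  induction terms with
  | nil => ext Q P; simp [rhsBr, SMat.eval_apply, SMat.entry_nil]
  | cons t ts ih =>
    have ht := h t List.mem_cons_self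
    rw [rhsBr, List.flatMap_cons, SMat.eval_append, SMat.eval_smul, SMat.eval_sbr' _ _ _ _ (wf_nodeS ht.1) (wf_nodeS ht.2),
      ← rhsBr, ih (fun t' ht' ↦ h t' (List.mem_cons_of_mem _ ht')), List.map_cons, List.sum_cons]

/-- Evaluation of the right-hand side of a target record. -/
theorem eval_rhsT (terms : List (ℕ × ℤ)) :
    (rhsT terms).eval = (terms.map fun t ↦ t.2 • (nodeS t.1).1.eval).sum := by
  induction terms with
  | nil => ext Q P; simp [rhsT, SMat.eval_apply, SMat.entry_nil]
  | cons t ts ih =>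
    rw [rhsT, List.flatMap_cons, SMat.eval_append, SMat.eval_smul, ← rhsT, ih, List.map_cons, List.sum_cons]

/-- A bracket record that checks gives the matrix identity of `LieCert`. -/
theorem of_checkBr {inL inR : ℕ → Bool} (hL : ∀ k, inL k = true → k < 447) (hR : ∀ k, inR k = true → k < 447)
    {r : ℕ × ℤ × List (ℕ × ℕ × ℤ)} (h : checkBr inL inR r = true) :
    r.2.1 ≠ 0 ∧ (∀ t ∈ r.2.2, inL t.1 = true ∧ inR t.2.1 = true) ∧
      r.2.1 • (nodeS r.1).1.eval = (r.2.2.map fun t ↦ t.2.2 •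
        sbrMat (nodeS t.1).1.eval (nodeS t.1).2.2 (nodeS t.2.1).1.eval (nodeS t.2.1).2.2).sum := by
  simp only [checkBr, Bool.and_eq_true, bne_iff_ne, ne_eq, List.all_eq_true] at h
  obtain ⟨⟨h0, hmem⟩, hbeq⟩ := h
  refine ⟨h0, hmem, ?_⟩
  rw [← SMat.eval_smul, SMat.eval_eq_of_beq hbeq,
    eval_rhsBr _ fun t ht ↦ ⟨hL _ (hmem t ht).1, hR _ (hmem t ht).2⟩]

end Cert

open Cert in
/-- (S-D) **The loop-superalgebra certificate (S2), kernel form** — registered stub `stub_cert` of the v2p5 skeleton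
of crux stmt-Ventures-20141: witnessed by the 447-node program `progData` with `E = eNodes`, `O = oNodes` and the
exact integer identities `claimEE`, `claimEO`, `claimT`, all verified by `decide` on sparse matrices. -/
theorem stub_cert : LieCert := by
  refine ⟨447, fun k ↦ (nodeS k).1.eval, fun k ↦ (nodeS k).2.1, fun k ↦ (nodeS k).2.2, isE, isO,
    ?_, fun k hk ↦ homog_nodeS hk, fun k hk ↦ lt_of_isE hk, fun k hk ↦ lt_of_isO hk, ?_, ?_, ?_, ?_⟩
  · -- program structure
    intro k hk
    have hc := checkNode_of_lt hk
    simp only [checkNode, Bool.and_eq_true] at hc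
    obtain ⟨-, hstruct⟩ := hc
    by_cases h0 : (progData.getD k (0, 0, 0)).1 = 0
    · rw [if_pos h0, decide_eq_true_eq] at hstruct
      have hgen : nodeS k = genS (progData.getD k (0, 0, 0)).2.1 := by rw [nodeS, stepS, if_pos h0]
      by_cases h14 : (progData.getD k (0, 0, 0)).2.1 < 14
      · refine Or.inl ⟨genMasks.get ⟨_, by simpa [genMasks] using h14⟩, deg4_genMasks ⟨_, h14⟩, ?_, ?_, ?_⟩ <;>
          simp only [hgen, genS, dif_pos h14, eval_mulS]
      · have h14' : (progData.getD k (0, 0, 0)).2.1 = 14 := by omega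
        refine Or.inr (Or.inl ⟨?_, ?_, ?_⟩) <;> simp only [hgen, genS, h14', lt_self_iff_false, eval_lamS, ↓reduceDIte]
    · rw [if_neg h0] at hstruct
      simp only [Bool.and_eq_true, beq_iff_eq, decide_eq_true_eq] at hstruct
      obtain ⟨⟨-, hi⟩, hj⟩ := hstruct
      have hbr : nodeS k = (SMat.sbr (nodeS (progData.getD k (0, 0, 0)).2.1).1 (nodeS (progData.getD k (0, 0, 0)).2.1).2.2
          (nodeS (progData.getD k (0, 0, 0)).2.2).1 (nodeS (progData.getD k (0, 0, 0)).2.2).2.2,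
          (nodeS (progData.getD k (0, 0, 0)).2.1).2.1 + (nodeS (progData.getD k (0, 0, 0)).2.2).2.1,
          (nodeS (progData.getD k (0, 0, 0)).2.1).2.2 + (nodeS (progData.getD k (0, 0, 0)).2.2).2.2) := by
        rw [nodeS, stepS, if_neg h0]
        simp only
        rw [nodesRev_getD (by omega), nodesRev_getD (by omega),
          show k - 1 - (k - 1 - (progData.getD k (0, 0, 0)).2.1) = (progData.getD k (0, 0, 0)).2.1 by omega,
          show k - 1 - (k - 1 - (progData.getD k (0, 0, 0)).2.2) = (progData.getD k (0, 0, 0)).2.2 by omega]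
      refine Or.inr (Or.inr ⟨_, hi, _, hj, ?_, ?_, ?_⟩)
      · dsimp only
        rw [hbr]; exact SMat.eval_sbr' _ _ _ _ (wf_nodeS (by omega)) (wf_nodeS (by omega))
      · dsimp only
        rw [hbr]
      · dsimp only
        rw [hbr]
  · -- [E,E] ⊇ E
    intro m hm
    have hc := checkEE_eq_true
    simp only [checkEE, Bool.and_eq_true, List.all_eq_true, List.any_eq_true, beq_iff_eq] at hc
    obtain ⟨hrec, hcov⟩ := hc
    obtain ⟨r, hr, hrm⟩ := hcov m (isE_iff.mp hm)
    obtain ⟨h0, hmem, hid⟩ := of_checkBr (fun k hk ↦ (lt_of_isE hk).1) (fun k hk ↦ (lt_of_isE hk).1) (hrec r hr)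
    exact ⟨r.2.1, r.2.2, h0, hmem, by rw [← hrm]; exact hid⟩
  · -- [E,O] ⊇ O
    intro m hm
    have hc := checkEOc_eq_true
    simp only [checkEOc, Bool.and_eq_true, List.all_eq_true, List.any_eq_true, beq_iff_eq] at hc
    obtain ⟨hrec, hcov⟩ := hc
    obtain ⟨r, hr, hrm⟩ := hcov m (isO_iff.mp hm)
    obtain ⟨h0, hmem, hid⟩ := of_checkBr (fun k hk ↦ (lt_of_isE hk).1) (fun k hk ↦ (lt_of_isO hk).1) (hrec r hr)
    exact ⟨r.2.1, r.2.2, h0, hmem, by rw [← hrm]; exact hid⟩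
  · -- the identity target
    have hc := checkT_eq_true
    simp only [checkT, Bool.and_eq_true, List.all_eq_true, List.any_eq_true, beq_iff_eq, bne_iff_ne, ne_eq,
      Bool.or_eq_true] at hc
    obtain ⟨hrec, hcov⟩ := hc
    obtain ⟨r, hr, hr0⟩ := hcov 0 (List.mem_range.mpr (by norm_num))
    obtain ⟨⟨h0, hmem⟩, hbeq⟩ := hrec r hr
    refine ⟨r.2.1, r.2.2, h0, hmem, ?_⟩
    rw [← eval_unitS_zero, ← hr0, ← SMat.eval_smul, SMat.eval_eq_of_beq hbeq, eval_rhsT]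
  · -- the matrix units E_{I,0}
    intro I hI
    have hc := checkT_eq_true
    simp only [checkT, Bool.and_eq_true, List.all_eq_true, List.any_eq_true, beq_iff_eq, bne_iff_ne, ne_eq,
      Bool.or_eq_true] at hc
    obtain ⟨hrec, hcov⟩ := hc
    obtain ⟨r, hr, hrI⟩ := hcov I.val (List.mem_range.mpr I.isLt)
    obtain ⟨⟨h0, hmem⟩, hbeq⟩ := hrec r hr
    refine ⟨r.2.1, r.2.2, h0, hmem, ?_⟩
    rw [← eval_unitS I hI, ← hrI, ← SMat.eval_smul, SMat.eval_eq_of_beq hbeq, eval_rhsT]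

end Summit.Ventures.HodgeKum4.L1Hilb

end
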